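import Summits.QuantumAdvantage.QuantumAdvantage.Theorems.SosSandwichTransferPBPotentialTree
import Summits.QuantumAdvantage.QuantumAdvantage.Theorems.SosSandwichTransferPBMachineReduction
import HarnessLib

/-!
# Crux `TransferPB` (stmt-QuantumAdvantage-15238, route SosSandwich), line `birth` — the machine reduction of `stub_pbOracleSimulation`, POTENTIAL FORM

Third form of the reduction of stub `stub_pbOracleSimulation` to its machine (after
`Theorems/SosSandwichTransferPBMachineReduction.lean` — least passing index — and `…MachineReductionPick.lean` —
any influence-certified pick), and the one a BBBV machine targets. A polynomial-time machine with a promise-`BQP`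
oracle finds, by heavy-prefix descent on gapped block tests, a FREE oracle bit of large average QUERY MAGNITUDE
`m̄_s(ρ)` of the restricted algorithm and queries it; it stops when no free bit has `m̄_s(ρ) ≥ τ₀`, which by the
Bennett–Bernstein–Brassard–Vazirani hybrid bound (`Inf_s[p_x|_ρ] ≤ 16·T·m̄_s(ρ)`) certifies that every
influence is `< w`; and the total free magnitude `Φ(ρ) = Σ_{s free} m̄_s(ρ) ≤ T` halves on average when a bit
is revealed. The analysis needs exactly: FRESH picks, a nonnegative POTENTIAL dropping by `τ` at picks, refusals
certifying all `Inf < w`, `1/20`-accurate leaf values, and a budget `D ≥ max(1, 2Φ([])/(τδ))` — with `Φ`, `τ`,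
`D` CHOSEN BY THE MACHINE (its running time is its own concern). This file proves the stub from that
hypothesis (`Theorems/SosSandwichTransferPBPotentialTree.lean` supplies the tree analysis, PB-AA the
completeness `Var > θ/2 ⇒ ∃ Inf ≥ w` along restrictions of `p_x ∈ K_{#gates}`):

* **`oracleSimulation_of_potentialMachines`**, **`stub_pbOracleSimulation_of_potentialMachines`**.

All proved; the machine hypothesis is a plain `Prop` argument (D-0026, no named fact). What remains for the
stub: (B) BBBV for restricted oracle circuits (`Inf_s[p_x|_ρ] ≤ 16T·m̄_s(ρ)`, `Σ_s m̄_s = T`, the halving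
identity); (Q) one promise problem in `PromiseBQP` encoding gapped magnitude block tests `m̄_{S_u}(ρ) ≥ a?`
and mean thresholds `E[p_x|_ρ] ≥ j/40?` (one-run estimator circuits with a random time step / the plain
restricted circuit, over a `2T`-wise independent hashed completion); (M) the transcript machine (prefix
descent, 40 mean queries — `thresholdCount_forty` — threshold bit), polynomial time. Source: S. Aaronson,
A. Ambainis, Theory Comput. 10 (2014), Thm. 21/23 (arXiv:0911.0996v3 pp. 13–14); C. H. Bennett,
E. Bernstein, G. Brassard, U. Vazirani, SIAM J. Comput. 26 (1997), Thm. 3.3.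
-/

-- D-0017: single-conjunct summit ⇒ the duplicate `QuantumAdvantage.QuantumAdvantage` is mandated.
set_option linter.dupNamespace false

noncomputable section

namespace Summit.QuantumAdvantage.QuantumAdvantage.Cruxes.TransferPB.Birth

open Finset MeasureTheory Literature.Computability.Cryptography Literature.Computability.Complexity
  Literature.Computability.QuantumComplexity Literature.Computability.QuantumComplexity.ClassicalSimulation
open Summit.QuantumAdvantage.QuantumAdvantage.Theses.SosSandwich
open scoped ENNReal

namespace SimTreePB

/-- **`OracleSimulation` from the machine half, potential form.** Granted the pseudo-boundedness of oracle
acceptance polynomials (stub 1) and PB-AA: if for all `c k`, every uniform `F` and polynomial `r` there are one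
`Q ∈ PromiseBQP` and one polynomial-time transcript machine `C` such that for every `x` (`n ≥ 1`) and every `g`
correct on `Q`'s promise there are an advisor `Adv`, a potential `Φ ≥ 0`, a drop `τ > 0` and a budget
`D ≥ max(1, 2Φ([])/(τδ))` with FRESH picks dropping the potential (`Φ(ρ·(i,0)) + Φ(ρ·(i,1)) + 2τ ≤ 2Φ(ρ)`),
refusals certifying `Inf_i[p_x|_ρ] < w` for all `i`, `1/20`-accurate leaf values, and
`C^{A ⊕ g}(x) = [advTree Adv D (A) ≥ 1/2]` — at `δ = 1/(r(n)+1)`, `w = 2^{-k}(((1/10)²δ/2)/2/d)^c`,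
`d = thm23Degree F x` — then Aaronson–Ambainis' average-case simulation relative to the promise oracle holds
with error `≤ 1/(r(n)+1)`. [cite: AaronsonAmbainis2014, Thm. 23 (proof, p. 14)] -/
theorem oracleSimulation_of_potentialMachines
    (hmach : ∀ (c k : ℕ) (F : QCircuitFamily cliffordT), F.IsUniform → ∀ r : Polynomial ℕ,
      ∃ Q ∈ Literature.Computability.Cryptography.PromiseBQP, ∃ (C : OracleAlg Bool) (q : Polynomial ℕ),
        C.IsPolyTime Computability.encodingBoolBool ∧
        (∀ (O : Oracle) (x : List Bool), ∀ y ∈ C.queries O (q.eval x.length) x, y.length ≤ q.eval x.length) ∧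
        ∀ x : List Bool, 1 ≤ x.length → ∀ g : List Bool → Bool,
          (∀ v ∈ Q.yes, g v = true) → (∀ v ∈ Q.no, g v = false) →
          ∃ (Adv : Advisor (numOracleBits F x)) (Φ : List (Fin (numOracleBits F x) × Bool) → ℝ) (τ : ℝ) (D : ℕ),
            0 < τ ∧ 0 < D ∧ 2 * Φ [] / (τ * (1 / (((r.eval x.length : ℕ) : ℝ) + 1))) ≤ D ∧
            (∀ (ρ : List (Fin (numOracleBits F x) × Bool)) (i : Fin (numOracleBits F x)),
              Adv.pick ρ = some i → i ∉ ρ.map Prod.fst) ∧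
            (∀ ρ : List (Fin (numOracleBits F x) × Bool), 0 ≤ Φ ρ) ∧
            (∀ (ρ : List (Fin (numOracleBits F x) × Bool)) (i : Fin (numOracleBits F x)), Adv.pick ρ = some i →
              Φ (ρ ++ [(i, false)]) + Φ (ρ ++ [(i, true)]) + 2 * τ ≤ 2 * Φ ρ) ∧
            (∀ ρ : List (Fin (numOracleBits F x) × Bool), Adv.pick ρ = none → ∀ i : Fin (numOracleBits F x),
              influence i (restrictPath ρ (acceptPoly F x)) <
                (1 / 2 ^ k : ℝ) * ((((1 / 10 : ℝ) ^ 2 * (1 / (((r.eval x.length : ℕ) : ℝ) + 1)) / 2) / 2) /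
                    thm23Degree F x) ^ c) ∧
            (∀ ρ : List (Fin (numOracleBits F x) × Bool),
              |Adv.val ρ - boolAvg (evalBool (restrictPath ρ (acceptPoly F x)))| ≤ 1 / 20) ∧
            ∀ A : Set (List Bool),
              C.run (Oracle.ofLanguage {w : List Bool | ∃ v : List Bool,
                  (w = false :: v ∧ v ∈ A) ∨ (w = true :: v ∧ g v = true)}) (q.eval x.length) x =
                some (decide (1 / 2 ≤ (advTree Adv D []).eval (oracleBits F x A)))) :
    Sig.stub_oracleAcceptPseudoBounded → PseudoBoundedAA → OracleSimulation := by
  intro h₁ hPB F hF r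
  obtain ⟨c, C₀, hC₀, HPB⟩ := pbInfluenceBound_of_pseudoBoundedAA hPB
  obtain ⟨k, HPBk⟩ := pbBound_dyadic hC₀ HPB
  obtain ⟨Q, hQ, C, q, hCpoly, hCq, hC⟩ := hmach c k F hF r
  refine ⟨Q, hQ, C, q, hCpoly, hCq, fun x hx g hgy hgn => ?_⟩
  obtain ⟨Adv, Φ, τ, D, hτ, hD0, hD, hfresh, hΦ0, hdrop, hnone, hval, hrun⟩ := hC x hx g hgy hgn
  -- parameters
  set δ : ℝ := 1 / (((r.eval x.length : ℕ) : ℝ) + 1) with hδ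
  have hδpos : 0 < δ := by positivity
  have hε : (0 : ℝ) < 1 / 10 := by norm_num
  have hd1 : 1 ≤ thm23Degree F x := by unfold thm23Degree; omega
  have hTd : (F.circ x.length).oracleQueries ≤ thm23Degree F x := by unfold thm23Degree; omega
  set θ : ℝ := (1 / 10 : ℝ) ^ 2 * δ / 2 with hθ
  have hθpos : 0 < θ := by positivity
  set w : ℝ := (1 / 2 ^ k : ℝ) * ((θ / 2) / thm23Degree F x) ^ c with hw
  have hK := h₁ F x
  have hcomplete := complete_of_pb (N := numOracleBits F x) (c := c) (C := (1 / 2 ^ k : ℝ)) hTd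
    (fun q' ε' hq hε' hv => HPBk _ _ q' ε' hd1 hq hε' hv) hK hθpos
  -- refusals certify small variance (all influences `< w` + completeness)
  have hnone' : ∀ ρ : List (Fin (numOracleBits F x) × Bool), Adv.pick ρ = none →
      boolVariance (restrictPath ρ (acceptPoly F x)) ≤ (1 / 10 : ℝ) ^ 2 * δ / 2 := by
    intro ρ hρ
    rw [← hθ]
    by_contra hbig
    have hbig' : θ / 2 < boolVariance (restrictPath ρ (acceptPoly F x)) := by
      have : θ / 2 ≤ θ := by linarith
      exact lt_of_le_of_lt this (not_le.1 hbig)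
    obtain ⟨i, hi⟩ := hcomplete ρ hbig'
    exact absurd (hnone ρ hρ i) (not_lt.2 hi)
  have hdev := measure_advTree_acceptPoly_deviation_le_pot F x hε hδpos hτ hfresh hΦ0 hdrop hnone' hval hD0 hD
  have hsub := threshold_subset_deviation F x (advTree Adv D []) (ε := 1 / 10) (η := 1 / 20) (by norm_num)
  have hset : {A : Set (List Bool) |
      (2 / 3 ≤ F.acceptProbOn A x ∧
        C.run (Oracle.ofLanguage {w : List Bool | ∃ v : List Bool,
            (w = false :: v ∧ v ∈ A) ∨ (w = true :: v ∧ g v = true)}) (q.eval x.length) x ≠ some true) ∨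
      (F.acceptProbOn A x ≤ 1 / 3 ∧
        C.run (Oracle.ofLanguage {w : List Bool | ∃ v : List Bool,
            (w = false :: v ∧ v ∈ A) ∨ (w = true :: v ∧ g v = true)}) (q.eval x.length) x ≠ some false)} =
      {A : Set (List Bool) |
        (2 / 3 ≤ F.acceptProbOn A x ∧ decide (1 / 2 ≤ (advTree Adv D []).eval (oracleBits F x A)) ≠ true) ∨
          (F.acceptProbOn A x ≤ 1 / 3 ∧
            decide (1 / 2 ≤ (advTree Adv D []).eval (oracleBits F x A)) ≠ false)} := by
    ext A
    simp only [Set.mem_setOf_eq, hrun A, ne_eq, Option.some.injEq]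
  show (ProbabilityTheory.setBernoulli (Set.univ : Set (List Bool)) ⟨1 / 2, by norm_num, by norm_num⟩) _ ≤ _
  change randomOracleMeasure _ ≤ _
  rw [hset]
  exact (measure_mono hsub).trans hdev

/-- **Stub `stub_pbOracleSimulation` from its machine, potential form** (see
`oracleSimulation_of_potentialMachines`; the intended instance is the BBBV magnitude machine).
[cite: AaronsonAmbainis2014, Thm. 23 (proof, p. 14)] -/
theorem stub_pbOracleSimulation_of_potentialMachines
    (hmach : ∀ (c k : ℕ) (F : QCircuitFamily cliffordT), F.IsUniform → ∀ r : Polynomial ℕ,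
      ∃ Q ∈ Literature.Computability.Cryptography.PromiseBQP, ∃ (C : OracleAlg Bool) (q : Polynomial ℕ),
        C.IsPolyTime Computability.encodingBoolBool ∧
        (∀ (O : Oracle) (x : List Bool), ∀ y ∈ C.queries O (q.eval x.length) x, y.length ≤ q.eval x.length) ∧
        ∀ x : List Bool, 1 ≤ x.length → ∀ g : List Bool → Bool,
          (∀ v ∈ Q.yes, g v = true) → (∀ v ∈ Q.no, g v = false) →
          ∃ (Adv : Advisor (numOracleBits F x)) (Φ : List (Fin (numOracleBits F x) × Bool) → ℝ) (τ : ℝ) (D : ℕ),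
            0 < τ ∧ 0 < D ∧ 2 * Φ [] / (τ * (1 / (((r.eval x.length : ℕ) : ℝ) + 1))) ≤ D ∧
            (∀ (ρ : List (Fin (numOracleBits F x) × Bool)) (i : Fin (numOracleBits F x)),
              Adv.pick ρ = some i → i ∉ ρ.map Prod.fst) ∧
            (∀ ρ : List (Fin (numOracleBits F x) × Bool), 0 ≤ Φ ρ) ∧
            (∀ (ρ : List (Fin (numOracleBits F x) × Bool)) (i : Fin (numOracleBits F x)), Adv.pick ρ = some i →
              Φ (ρ ++ [(i, false)]) + Φ (ρ ++ [(i, true)]) + 2 * τ ≤ 2 * Φ ρ) ∧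
            (∀ ρ : List (Fin (numOracleBits F x) × Bool), Adv.pick ρ = none → ∀ i : Fin (numOracleBits F x),
              influence i (restrictPath ρ (acceptPoly F x)) <
                (1 / 2 ^ k : ℝ) * ((((1 / 10 : ℝ) ^ 2 * (1 / (((r.eval x.length : ℕ) : ℝ) + 1)) / 2) / 2) /
                    thm23Degree F x) ^ c) ∧
            (∀ ρ : List (Fin (numOracleBits F x) × Bool),
              |Adv.val ρ - boolAvg (evalBool (restrictPath ρ (acceptPoly F x)))| ≤ 1 / 20) ∧
            ∀ A : Set (List Bool),
              C.run (Oracle.ofLanguage {w : List Bool | ∃ v : List Bool,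
                  (w = false :: v ∧ v ∈ A) ∨ (w = true :: v ∧ g v = true)}) (q.eval x.length) x =
                some (decide (1 / 2 ≤ (advTree Adv D []).eval (oracleBits F x A)))) :
    Sig.stub_pbOracleSimulation :=
  oracleSimulation_of_potentialMachines hmach

end SimTreePB

end Summit.QuantumAdvantage.QuantumAdvantage.Cruxes.TransferPB.Birth

end
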